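import Summits.QuantumFields.QCD.Theses.WilsonQuarkChessboard
import Summits.QuantumFields.QCD.Theses.RenormalisedVafaWitten
import Summits.QuantumFields.QCD.Theorems.WilsonQuarkChessboardQuarkChessboard

/-!
# Crux `WilsonQuarkChessboard.MassiveBridge` (stmt-QuantumFields-17577), line `registered`, stub
`stub_dominationUV` — reduction to the shared UV item stmt-QuantumFields-8695 (helper file, `--supports`)

The gen-2 skeleton `Cruxes/MassiveBridge/Lines/birth.lean` cuts the crux into three laws; the ultraviolet one is
the registered stub `stub_dominationUV : DominationUVStmt`,

  `QuarkChessboard → FlatCellOptimal → ThresholdContinuum`,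
  `ThresholdContinuum := ∀ N_f ∈ {2,3}, ∃ M₀ ≥ 0, ∃ reg, reg.HasMassScaling ∧ ContinuumDataAbove N_f reg M₀`,

where `ContinuumDataAbove N_f reg M₀` says that every mass tuple `m` with all `m_f > M₀` carries species
renormalisations `(z, shift)` and OS data `T` with `IsQCDAlong (reg.scheme m z shift) T`, non-trivial non-Gaussian
glue and non-decoupled flavour-changing pseudoscalars `Re ψ̄_f iγ₅ ψ_g` (`f ≠ g`).  This is four-dimensional
constructive QCD with dynamical Wilson quarks (no gap claimed) — an OPEN PROBLEM; nobody proves it in a session.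
Its hypotheses C (`QuarkChessboard`, PROVED: `wilsonQuarkChessboardQuarkChessboard_proof`) and K (`FlatCellOptimal`)
are logically idle, and its conclusion is, up to the flavour-blind offset shift
`m_crit(k) ↦ m_crit(k) + a_k M₀ / Z_m(k)`, the body of the shared support item
`RenormalisedVafaWitten.DynamicalQuarkContinuum` (stmt-QuantumFields-8695; identical body:
`HeatSlicedQuarks.ContinuumQCDExists`, stmt-QuantumFields-8870), which is OPEN (ledger 2026-08-17: 8695 open,
8870 open; `lean search`: no proof of either in the tree, only conditionals/equivalences).

This file records the durable reduction, sorry-free, with every statement INLINED over the Statement's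
vocabulary (the skeleton's `def`s live in a crux workfile and are not importable; the inlined texts are the
delta-unfoldings of `ThresholdContinuum` / `DominationUVStmt`, so the lead rewrites with these lemmas by `Iff.rfl`):

* `massiveBridge_dominationUV_schemeOffsetShift` — the offset shift: the regularisation with critical mass
  `m_crit(k) + a_k M / Z_m(k)` has at the tuple `m` literally the scheme of `reg` at `m + M` (content of
  `GradientFlowSpecies.OffsetShift`, stmt-QuantumFields-8924, reproved in three lines to keep the import cone
  inside this route); `massiveBridge_dominationUV_hasMassScaling_offsetShift_iff` — it does not touch `Z_m, a`.
* `massiveBridge_thresholdContinuum_iff_offsetFree` — `ThresholdContinuum ↔` (offset-free body of 8695):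
  `←` is `M₀ = 0`; `→` shifts the offset into `m_crit`.
* `massiveBridge_dominationUV_iff` — `(C → K → ThresholdContinuum) ↔ (K → offset-free body)`, discharging C by
  the landed proof.
* `massiveBridge_dominationUV_iff_dynamicalQuarkContinuum` — the same with the right-hand side spelled BY NAME,
  `FlatCellOptimal → RenormalisedVafaWitten.DynamicalQuarkContinuum`; and the modus-ponens corollary
  `massiveBridge_dominationUV_of_dynamicalQuarkContinuum` (8695 ⇒ the stub's statement), which is how the stub
  closes the day 8695 lands.

Hence `stub_dominationUV` is exactly the debt of item stmt-QuantumFields-8695 modulo the idle hypothesis K.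

References: Montvay–Münster 1994 §5.1 (Wilson quark masses, critical hopping parameter, additive mass
renormalisation is flavour-blind); Jaffe–Witten 2000 §5 (existence of QCD with quarks as the UV half of the
problem); Bałaban 1989 (large-field renormalisation, the intended consumer of C ∧ K).
-/

namespace Summit.QuantumFields.QCD.Theorems

open Literature.MathematicalPhysics.QuantumFieldTheory
open Summit.QuantumFields.QCD.Theses.WilsonQuarkChessboard

/-- **The offset shift of a regularisation** (Montvay–Münster §5.1: the additive mass renormalisation of Wilson
fermions is flavour-blind): shifting `m_crit(k)` by `a_k M / Z_m(k)` realises the tuple `m` exactly as `reg`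
realises `m + M`; every other datum of the scheme (`a, β, L, z, shift`) is untouched.  Definitional (`ring`);
same content as `GradientFlowSpecies.OffsetShift` (stmt-QuantumFields-8924). [cite: MontvayMunster1994, §5.1] -/
theorem massiveBridge_dominationUV_schemeOffsetShift {Nf : ℕ} (reg : QCDRegularisation Nf) (M : ℝ)
    (m : Fin Nf → ℝ) (z shift : QCDField Nf → ℕ → ℝ) :
    ({ reg with mcrit := fun k => reg.mcrit k + reg.a k * M / reg.Zm k } : QCDRegularisation Nf).scheme m z
        shift = reg.scheme (fun f => m f + M) z shift := by
  simp only [QCDRegularisation.scheme, QCDScheme.mk.injEq, true_and, and_true]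
  funext f k
  ring

/-- The offset shift does not touch `Z_m` or `a`: leading-log mass scaling is unchanged (definitional).
[cite: MontvayMunster1994, §5.1] -/
theorem massiveBridge_dominationUV_hasMassScaling_offsetShift_iff {Nf : ℕ} (reg : QCDRegularisation Nf)
    (M : ℝ) :
    ({ reg with mcrit := fun k => reg.mcrit k + reg.a k * M / reg.Zm k } : QCDRegularisation Nf).HasMassScaling ↔
      reg.HasMassScaling :=
  Iff.rfl

/-- **Threshold continuum ⇔ offset-free continuum.**  For `N_f ∈ {2,3}`: "there are an offset `M₀ ≥ 0` and a
mass-independent regularisation with `HasMassScaling` carrying, for every tuple above `M₀`, OS data along the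
scheme with non-trivial non-Gaussian glue and non-decoupled flavour-changing pseudoscalars" (the skeleton's
`ThresholdContinuum`, inlined) is EQUIVALENT to the same for all positive tuples (`∀ m > 0`: verbatim the body of
the shared item `RenormalisedVafaWitten.DynamicalQuarkContinuum`, stmt-QuantumFields-8695, =
`HeatSlicedQuarks.ContinuumQCDExists`, stmt-QuantumFields-8870).  `←`: take `M₀ = 0`.  `→`: replace `reg` by the
regularisation with critical mass `m_crit(k) + a_k M₀ / Z_m(k)` (`massiveBridge_dominationUV_schemeOffsetShift`),
which realises `m > 0` as `reg` realises `m + M₀ > M₀` and has the same `Z_m, a`.  The offset is free because the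
additive Wilson mass renormalisation is only fixed up to `O(aΛ)` in lattice units, the order of `a_k m_f / Z_m(k)`.
[cite: MontvayMunster1994, §5.1] [cite: JaffeWitten2000, §5] -/
theorem massiveBridge_thresholdContinuum_iff_offsetFree :
    (∀ Nf : ℕ, Nf = 2 ∨ Nf = 3 → ∃ M₀ : ℝ, 0 ≤ M₀ ∧ ∃ reg : QCDRegularisation Nf,
      reg.HasMassScaling ∧ ∀ m : Fin Nf → ℝ, (∀ f, M₀ < m f) →
        ∃ (z shift : QCDField Nf → ℕ → ℝ) (T : OSData (QCDField Nf) 4),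
          IsQCDAlong (reg.scheme m z shift) T ∧ T.IsNontrivial QCDField.glue ∧
            T.IsNonGaussian QCDField.glue ∧
              ∀ f g : Fin Nf, f ≠ g → T.IsNontrivial (QCDField.pseudoRe f g)) ↔
    (∀ Nf : ℕ, (Nf = 2 ∨ Nf = 3) → ∃ reg : QCDRegularisation Nf, reg.HasMassScaling ∧
      ∀ m : Fin Nf → ℝ, (∀ f, 0 < m f) →
        ∃ (z shift : QCDField Nf → ℕ → ℝ) (T : OSData (QCDField Nf) 4),
          IsQCDAlong (reg.scheme m z shift) T ∧ T.IsNontrivial QCDField.glue ∧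
            T.IsNonGaussian QCDField.glue ∧
              ∀ f g : Fin Nf, f ≠ g → T.IsNontrivial (QCDField.pseudoRe f g)) := by
  constructor
  · -- shift the offset into the critical bare mass
    intro h Nf hNf
    obtain ⟨M₀, -, reg, hms, hdata⟩ := h Nf hNf
    refine ⟨{ reg with mcrit := fun k => reg.mcrit k + reg.a k * M₀ / reg.Zm k },
      (massiveBridge_dominationUV_hasMassScaling_offsetShift_iff reg M₀).2 hms, fun m hm => ?_⟩
    obtain ⟨z, shift, T, hqcd, hglue, hng, hps⟩ :=
      hdata (fun f => m f + M₀) fun f => lt_add_of_pos_left M₀ (hm f)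
    refine ⟨z, shift, T, ?_, hglue, hng, hps⟩
    rwa [massiveBridge_dominationUV_schemeOffsetShift reg M₀ m z shift]
  · -- specialise the offset to `M₀ = 0`
    intro h Nf hNf
    obtain ⟨reg, hms, hdata⟩ := h Nf hNf
    exact ⟨0, le_rfl, reg, hms, hdata⟩

/-- **The UV stub ⇔ (K ⇒ offset-free continuum).**  The registered stub `stub_dominationUV : DominationUVStmt`
(`QuarkChessboard → FlatCellOptimal → ThresholdContinuum`, inlined) is EQUIVALENT to
`FlatCellOptimal →` (offset-free body of stmt-QuantumFields-8695): the quark chessboard C is PROVED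
(`wilsonQuarkChessboardQuarkChessboard_proof`, item stmt-QuantumFields-9306 @ b37869be232f), so it is discharged,
and the threshold form is the offset-free form by `massiveBridge_thresholdContinuum_iff_offsetFree`.  The
flat-cell optimum K stays as an (idle) hypothesis on both sides. [cite: JaffeWitten2000, §5] [cite: MontvayMunster1994, §5.1] -/
theorem massiveBridge_dominationUV_iff :
    (QuarkChessboard → FlatCellOptimal →
      ∀ Nf : ℕ, Nf = 2 ∨ Nf = 3 → ∃ M₀ : ℝ, 0 ≤ M₀ ∧ ∃ reg : QCDRegularisation Nf,
        reg.HasMassScaling ∧ ∀ m : Fin Nf → ℝ, (∀ f, M₀ < m f) →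
          ∃ (z shift : QCDField Nf → ℕ → ℝ) (T : OSData (QCDField Nf) 4),
            IsQCDAlong (reg.scheme m z shift) T ∧ T.IsNontrivial QCDField.glue ∧
              T.IsNonGaussian QCDField.glue ∧
                ∀ f g : Fin Nf, f ≠ g → T.IsNontrivial (QCDField.pseudoRe f g)) ↔
    (FlatCellOptimal →
      ∀ Nf : ℕ, (Nf = 2 ∨ Nf = 3) → ∃ reg : QCDRegularisation Nf, reg.HasMassScaling ∧
        ∀ m : Fin Nf → ℝ, (∀ f, 0 < m f) →
          ∃ (z shift : QCDField Nf → ℕ → ℝ) (T : OSData (QCDField Nf) 4),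
            IsQCDAlong (reg.scheme m z shift) T ∧ T.IsNontrivial QCDField.glue ∧
              T.IsNonGaussian QCDField.glue ∧
                ∀ f g : Fin Nf, f ≠ g → T.IsNontrivial (QCDField.pseudoRe f g)) := by
  constructor
  · intro h hK
    exact massiveBridge_thresholdContinuum_iff_offsetFree.1 (h wilsonQuarkChessboardQuarkChessboard_proof hK)
  · intro h _hC hK
    exact massiveBridge_thresholdContinuum_iff_offsetFree.2 (h hK)

/-- **The UV stub ⇔ (K ⇒ `DynamicalQuarkContinuum`), by name.**  The registered stub
`QuarkChessboard → FlatCellOptimal → ThresholdContinuum` (inlined) is EQUIVALENT to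
`FlatCellOptimal → RenormalisedVafaWitten.DynamicalQuarkContinuum` (item stmt-QuantumFields-8695, the UV existence
half shared by every QCD line, OPEN): `stub_dominationUV` is that item's debt modulo the idle hypothesis K.
[cite: JaffeWitten2000, §5] [cite: MontvayMunster1994, §5.1] -/
theorem massiveBridge_dominationUV_iff_dynamicalQuarkContinuum :
    (QuarkChessboard → FlatCellOptimal →
      ∀ Nf : ℕ, Nf = 2 ∨ Nf = 3 → ∃ M₀ : ℝ, 0 ≤ M₀ ∧ ∃ reg : QCDRegularisation Nf,
        reg.HasMassScaling ∧ ∀ m : Fin Nf → ℝ, (∀ f, M₀ < m f) →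
          ∃ (z shift : QCDField Nf → ℕ → ℝ) (T : OSData (QCDField Nf) 4),
            IsQCDAlong (reg.scheme m z shift) T ∧ T.IsNontrivial QCDField.glue ∧
              T.IsNonGaussian QCDField.glue ∧
                ∀ f g : Fin Nf, f ≠ g → T.IsNontrivial (QCDField.pseudoRe f g)) ↔
    (FlatCellOptimal → Summit.QuantumFields.QCD.Theses.RenormalisedVafaWitten.DynamicalQuarkContinuum) :=
  massiveBridge_dominationUV_iff

/-- **8695 ⇒ the UV stub** (modus ponens form, for the day the shared item lands): from
`RenormalisedVafaWitten.DynamicalQuarkContinuum` the registered statement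
`QuarkChessboard → FlatCellOptimal → ThresholdContinuum` (inlined) follows with offset `M₀ = 0`, both hypotheses
unused. [cite: JaffeWitten2000, §5] -/
theorem massiveBridge_dominationUV_of_dynamicalQuarkContinuum
    (hUV : Summit.QuantumFields.QCD.Theses.RenormalisedVafaWitten.DynamicalQuarkContinuum) :
    QuarkChessboard → FlatCellOptimal →
      ∀ Nf : ℕ, Nf = 2 ∨ Nf = 3 → ∃ M₀ : ℝ, 0 ≤ M₀ ∧ ∃ reg : QCDRegularisation Nf,
        reg.HasMassScaling ∧ ∀ m : Fin Nf → ℝ, (∀ f, M₀ < m f) →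
          ∃ (z shift : QCDField Nf → ℕ → ℝ) (T : OSData (QCDField Nf) 4),
            IsQCDAlong (reg.scheme m z shift) T ∧ T.IsNontrivial QCDField.glue ∧
              T.IsNonGaussian QCDField.glue ∧
                ∀ f g : Fin Nf, f ≠ g → T.IsNontrivial (QCDField.pseudoRe f g) :=
  fun _hC _hK => massiveBridge_thresholdContinuum_iff_offsetFree.2 hUV

end Summit.QuantumFields.QCD.Theorems
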